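import Literature.MathematicalPhysics.QuantumFieldTheory.UnitaryCayleyChart
import Literature.MathematicalPhysics.QuantumLattice.RepLieAlgebra
import Literature.Analysis.Calculus.ClosedSubgroupExpChart
import Summits.QuantumFields.YangMills.Theorems.EquipartitionCriticalityFreeEnergyLogCoefficientDefs
import Summits.QuantumFields.YangMills.Theorems.EquipartitionCriticalityFreeEnergyLogCoefficientExpLipschitz
import HarnessLib

/-!
# The exponential chart of a compact matrix group: basic properties

Crux `FreeEnergyLogCoefficient` of route `EquipartitionCriticality` (`QuantumFields/YangMills`), line
`Sketch`, stub `stub_expChartPackage`, second file. For a continuous unitary-valued representation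
`ρ : G →* M_N(ℂ)` of a compact group (faithful where stated) and the definitions `liePre`, `dimE`,
`lieIso`, `expChart`, `κE` of the Defs file:

* `lieIso_mem`, `conjTranspose_lieIso`, `norm_lieIso`, `exists_lieIso_eq`, `dimE_eq_finrank` — `lieIso ρ`
  is an isometric parametrisation of the Lie algebra `𝔤_ρ = matrixLieAlgebra (range ρ) ⊆ 𝔲(N)`
  (tree: `matrixLieAlgebra_le_skewAdjoint`, `UnitaryCayley.skewOf`), and `dimE ρ = dim_ℝ 𝔤_ρ`;
* `rho_expChart` (`ρ ∘ ψ = exp ∘ lieIso ρ`, closed-subgroup theorem `mem_matrixLieAlgebra_iff`),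
  `expChart_zero`, `continuous_expChart` (`ρ` is a closed embedding);
* `norm_rho_expChart_sub_le` (the chart is `1`-Lipschitz in Hilbert–Schmidt distance,
  `norm_exp_sub_exp_le_of_skew`), `le_norm_rho_expChart_sub` (inverse Lipschitz, Chatterjee Lemma 11.2);
* `exists_chart_radius` — von Neumann's local surjectivity (`exists_exp_chart_range`): every `g` with
  `‖ρ g − 1‖ < r₀` is `ψ a` with `‖a‖ ≤ 2‖ρ g − 1‖`;
* `κE_eq`, `one_le_κE`, `κE_le_two`, `log_κE_le` — the distortion `κE(r) = (2 − e^{4r})⁻¹` for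
  `r ≤ 1/16`, `1 ≤ κE ≤ 2`, `log κE(r) ≤ 16 r`.

Reference: S. Chatterjee, arXiv:1602.01222, §11 (Lemma 11.2, Cor. 11.3); J. von Neumann (1929).
-/

noncomputable section

open scoped Matrix Matrix.Norms.Frobenius Topology
open NormedSpace Filter Set
open Literature.MathematicalPhysics.QuantumLattice Literature.MathematicalPhysics.QuantumFieldTheory

namespace Summit.QuantumFields.YangMills.Theorems.FreeEnergyLogCoefficient

-- NEEDS ExpChart
-- BODY START
/-! ### The isometric parametrisation of the Lie algebra -/

section LieIso

variable {N : ℕ} {G : Type*} [Group G] (ρ : G →* (Matrix (Fin N) (Fin N) ℂ))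

/-- `lieIso ρ a` lies in the Lie algebra `matrixLieAlgebra (range ρ)`. [folklore] -/
theorem lieIso_mem (a : (EuclideanSpace ℝ (Fin (dimE ρ)))) :
    lieIso ρ a ∈ matrixLieAlgebra (Set.range ρ) :=
  ((stdOrthonormalBasis ℝ ↥(liePre ρ)).repr.symm a).2

/-- `lieIso ρ a` is skew-Hermitian. [folklore] -/
theorem conjTranspose_lieIso (a : (EuclideanSpace ℝ (Fin (dimE ρ)))) : (lieIso ρ a)ᴴ = -(lieIso ρ a) :=
  UnitaryCayley.conjTranspose_skewOf _

/-- `lieIso ρ` is norm preserving (Euclidean to Frobenius). [folklore] -/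
theorem norm_lieIso (a : (EuclideanSpace ℝ (Fin (dimE ρ)))) : ‖lieIso ρ a‖ = ‖a‖ :=
  (lieIso ρ).norm_map a

/-- For unitary-valued `ρ`, elements of the Lie algebra are skew-Hermitian. [cite: Hall2015, Proposition 3.24] -/
theorem conjTranspose_eq_neg_of_mem (hU : ∀ g, ρ g ∈ Matrix.unitaryGroup (Fin N) ℂ) {X : (Matrix (Fin N) (Fin N) ℂ)}
    (hX : X ∈ matrixLieAlgebra (Set.range ρ)) : Xᴴ = -X := by
  have hsub : Set.range ρ ⊆ (Matrix.unitaryGroup (Fin N) ℂ : Set (Matrix (Fin N) (Fin N) ℂ)) := by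
    rintro _ ⟨g, rfl⟩; exact hU g
  exact skewAdjoint.mem_iff.1 (matrixLieAlgebra_le_skewAdjoint hsub hX)

/-- For unitary-valued `ρ`, `skewOf` maps `liePre ρ` ONTO the Lie algebra. [folklore] -/
theorem exists_mem_liePre (hU : ∀ g, ρ g ∈ Matrix.unitaryGroup (Fin N) ℂ) {X : (Matrix (Fin N) (Fin N) ℂ)}
    (hX : X ∈ matrixLieAlgebra (Set.range ρ)) :
    ∃ v ∈ liePre ρ, UnitaryCayley.skewOf v = X := by
  have hskew := conjTranspose_eq_neg_of_mem ρ hU hX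
  refine ⟨UnitaryCayley.unskew X, ?_, UnitaryCayley.skewOf_unskew hskew⟩
  show UnitaryCayley.skewOf (UnitaryCayley.unskew X) ∈ matrixLieAlgebra (Set.range ρ)
  rwa [UnitaryCayley.skewOf_unskew hskew]

/-- For unitary-valued `ρ`, `lieIso ρ` is onto the Lie algebra. [folklore] -/
theorem exists_lieIso_eq (hU : ∀ g, ρ g ∈ Matrix.unitaryGroup (Fin N) ℂ) {X : (Matrix (Fin N) (Fin N) ℂ)}
    (hX : X ∈ matrixLieAlgebra (Set.range ρ)) : ∃ a, lieIso ρ a = X := by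
  obtain ⟨v, hv, hvX⟩ := exists_mem_liePre ρ hU hX
  refine ⟨(stdOrthonormalBasis ℝ ↥(liePre ρ)).repr ⟨v, hv⟩, ?_⟩
  show UnitaryCayley.skewOf
    (((stdOrthonormalBasis ℝ ↥(liePre ρ)).repr.symm ((stdOrthonormalBasis ℝ ↥(liePre ρ)).repr ⟨v, hv⟩) :
      UnitaryCayley.𝔼 N)) = X
  rw [LinearIsometryEquiv.symm_apply_apply]
  exact hvX

/-- **The chart dimension is the dimension of the Lie algebra**: `dimE ρ = dim_ℝ 𝔤_ρ` for
unitary-valued `ρ` (`skewOf` restricts to a linear isomorphism `liePre ρ ≃ 𝔤_ρ`). [cite: Hall2015, Definition 3.18] -/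
theorem dimE_eq_finrank (hU : ∀ g, ρ g ∈ Matrix.unitaryGroup (Fin N) ℂ) :
    dimE ρ = Module.finrank ℝ ↥(matrixLieAlgebra (Set.range ρ)) := by
  set f : UnitaryCayley.𝔼 N →ₗ[ℝ] (Matrix (Fin N) (Fin N) ℂ) := (UnitaryCayley.skewOf (N := N)).toLinearMap with hf
  have hinj : Function.Injective f := (UnitaryCayley.skewOf (N := N)).injective
  have hmap : (liePre ρ).map f = matrixLieAlgebra (Set.range ρ) := by
    rw [show liePre ρ = (matrixLieAlgebra (Set.range ρ)).comap f from rfl, Submodule.map_comap_eq,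
      inf_eq_right]
    intro X hX
    obtain ⟨v, -, hv⟩ := exists_mem_liePre ρ hU hX
    exact ⟨v, hv⟩
  have e : ↥(liePre ρ) ≃ₗ[ℝ] ↥(matrixLieAlgebra (Set.range ρ)) :=
    (Submodule.equivMapOfInjective f hinj (liePre ρ)).trans (LinearEquiv.ofEq _ _ hmap)
  exact e.finrank_eq

end LieIso

/-! ### The chart: `ρ ∘ ψ = exp ∘ lieIso`, continuity, Lipschitz bounds, local surjectivity -/

section Chart

variable {N : ℕ} {G : Type*} [Group G] [TopologicalSpace G] [CompactSpace G]
  (ρ : G →* (Matrix (Fin N) (Fin N) ℂ))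

/-- `exp (lieIso ρ a)` lies in the (closed) image of `ρ` (closed-subgroup theorem for `range ρ`). [cite: Hall2015, Theorem 3.20] -/
theorem exp_lieIso_mem_range (hρ : Continuous ρ) (a : (EuclideanSpace ℝ (Fin (dimE ρ)))) :
    exp (lieIso ρ a) ∈ Set.range ρ := by
  have hH : IsClosed (Set.range ρ) := (isCompact_range hρ).isClosed
  have h1 : (1 : (Matrix (Fin N) (Fin N) ℂ)) ∈ Set.range ρ := ⟨1, map_one ρ⟩
  have hmul : ∀ x ∈ Set.range ρ, ∀ y ∈ Set.range ρ, x * y ∈ Set.range ρ := by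
    rintro _ ⟨x, rfl⟩ _ ⟨y, rfl⟩; exact ⟨x * y, map_mul ρ x y⟩
  have h := (mem_matrixLieAlgebra_iff h1 hmul hH).1 (lieIso_mem ρ a) 1
  rwa [one_smul] at h

/-- **The chart lands where it should**: `ρ (expChart ρ a) = exp (lieIso ρ a)`. [cite: arXiv160201222, §11] -/
theorem rho_expChart (hρ : Continuous ρ) (a : (EuclideanSpace ℝ (Fin (dimE ρ)))) :
    ρ (expChart ρ a) = exp (lieIso ρ a) :=
  Function.invFun_eq (exp_lieIso_mem_range ρ hρ a)

/-- `expChart ρ 0 = 1` for faithful `ρ`. [folklore] -/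
theorem expChart_zero (hρ : Continuous ρ) (hinj : Function.Injective ρ) : expChart ρ 0 = 1 :=
  hinj (by rw [rho_expChart ρ hρ, map_zero, exp_zero, map_one])

/-- **The exponential chart is continuous** (for faithful `ρ`, a closed embedding of the compact group). [folklore] -/
theorem continuous_expChart (hρ : Continuous ρ) (hinj : Function.Injective ρ) :
    Continuous (expChart ρ) := by
  have hemb : Topology.IsClosedEmbedding ρ := hρ.isClosedEmbedding hinj
  rw [hemb.isEmbedding.continuous_iff]
  have heq : (ρ : G → (Matrix (Fin N) (Fin N) ℂ)) ∘ expChart ρ = fun a => exp (lieIso ρ a) := funext (rho_expChart ρ hρ)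
  rw [heq]
  exact exp_continuous.comp (lieIso ρ).continuous

/-- `expChart` is measurable for any Borel structure on `G`. [folklore] -/
theorem measurable_expChart [MeasurableSpace G] [BorelSpace G] (hρ : Continuous ρ)
    (hinj : Function.Injective ρ) : Measurable (expChart ρ) :=
  (continuous_expChart ρ hρ hinj).measurable

/-- **The chart is `1`-Lipschitz in Hilbert–Schmidt distance**: `‖ρ(ψ a) − ρ(ψ b)‖_F ≤ ‖a − b‖`
(`exp` is `1`-Lipschitz on `𝔲(N)` and `lieIso` is an isometry). [cite: arXiv160201222, Cor. 11.3] -/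
theorem norm_rho_expChart_sub_le (hρ : Continuous ρ) (a b : (EuclideanSpace ℝ (Fin (dimE ρ)))) :
    ‖ρ (expChart ρ a) - ρ (expChart ρ b)‖ ≤ ‖a - b‖ := by
  rw [rho_expChart ρ hρ, rho_expChart ρ hρ]
  calc ‖exp (lieIso ρ a) - exp (lieIso ρ b)‖ ≤ ‖lieIso ρ a - lieIso ρ b‖ :=
        norm_exp_sub_exp_le_of_skew (conjTranspose_lieIso ρ a) (conjTranspose_lieIso ρ b)
    _ = ‖a - b‖ := by rw [← map_sub, norm_lieIso]

/-- `‖ρ(ψ a) − 1‖_F ≤ ‖a‖`. [cite: arXiv160201222, Cor. 11.3] -/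
theorem norm_rho_expChart_sub_one_le (hρ : Continuous ρ) (hinj : Function.Injective ρ)
    (a : (EuclideanSpace ℝ (Fin (dimE ρ)))) : ‖ρ (expChart ρ a) - 1‖ ≤ ‖a‖ := by
  have h := norm_rho_expChart_sub_le ρ hρ a 0
  rwa [expChart_zero ρ hρ hinj, map_one, sub_zero] at h

/-- **Inverse Lipschitz bound of the chart** (Chatterjee Lemma 11.2): for `‖a‖, ‖b‖ ≤ r`,
`(2 − e^r) ‖a − b‖ ≤ ‖ρ(ψ a) − ρ(ψ b)‖_F`. [cite: arXiv160201222, Lemma 11.2] -/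
theorem le_norm_rho_expChart_sub (hρ : Continuous ρ) {a b : (EuclideanSpace ℝ (Fin (dimE ρ)))} {r : ℝ}
    (ha : ‖a‖ ≤ r) (hb : ‖b‖ ≤ r) :
    (2 - Real.exp r) * ‖a - b‖ ≤ ‖ρ (expChart ρ a) - ρ (expChart ρ b)‖ := by
  rw [rho_expChart ρ hρ, rho_expChart ρ hρ]
  have ha' : ‖lieIso ρ a‖ ≤ r := by rwa [norm_lieIso]
  have hb' : ‖lieIso ρ b‖ ≤ r := by rwa [norm_lieIso]
  have h := sub_mul_norm_sub_le_norm_exp_sub_exp ha' hb'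
  rwa [← map_sub, norm_lieIso] at h

/-- **von Neumann's local surjectivity for the chart**: there is `r₀ > 0` such that every `g` with
`‖ρ g − 1‖_F < r₀` is `expChart ρ a` for some `a` with `‖a‖ ≤ 2 ‖ρ g − 1‖_F`. [cite: vonNeumann1929, §3] -/
theorem exists_chart_radius (hρ : Continuous ρ) (hinj : Function.Injective ρ)
    (hU : ∀ g, ρ g ∈ Matrix.unitaryGroup (Fin N) ℂ) :
    ∃ r₀ : ℝ, 0 < r₀ ∧ ∀ g : G, ‖ρ g - 1‖ < r₀ →
      ∃ a : (EuclideanSpace ℝ (Fin (dimE ρ))), expChart ρ a = g ∧ ‖a‖ ≤ 2 * ‖ρ g - 1‖ := by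
  obtain ⟨r₀, hr₀, h⟩ := Literature.Analysis.Calculus.exists_exp_chart_range ρ hρ
  refine ⟨r₀, hr₀, fun g hg => ?_⟩
  obtain ⟨X, hX, hXg, hXn⟩ := h g hg
  have hgen : X ∈ oneParamGenerators (Set.range ρ) := fun t => by
    obtain ⟨k, hk⟩ := hX t
    exact ⟨k, hk⟩
  obtain ⟨a, ha⟩ := exists_lieIso_eq ρ hU (mem_matrixLieAlgebra_of_mem hgen)
  refine ⟨a, hinj ?_, ?_⟩
  · rw [rho_expChart ρ hρ, ha, hXg]
  · rw [← norm_lieIso ρ a, ha]; exact hXn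

end Chart

/-! ### The distortion function `κE` -/

section Kappa

/-- For `r ≤ 1/16`, `e^{4r} ≤ 4/3`. [folklore] -/
theorem exp_four_mul_le {r : ℝ} (hr : r ≤ 1 / 16) : Real.exp (4 * r) ≤ 4 / 3 := by
  have h1 : Real.exp (4 * r) ≤ Real.exp (1 / 4) := Real.exp_le_exp.2 (by linarith)
  have h2 : Real.exp (1 / 4) ≤ 4 / 3 := by
    have h := Real.one_sub_le_exp_neg (1 / 4 : ℝ)
    have hpos : 0 < Real.exp (-(1 / 4 : ℝ)) := Real.exp_pos _
    have hmul : Real.exp (1 / 4) * Real.exp (-(1 / 4 : ℝ)) = 1 := by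
      rw [← Real.exp_add]; norm_num
    nlinarith
  exact h1.trans h2

/-- On `[0, 1/16]` the cap in `κE` is inactive: `κE r = (2 − e^{4r})⁻¹`. [folklore] -/
theorem κE_eq {r : ℝ} (hr : r ≤ 1 / 16) : κE r = (2 - Real.exp (4 * r))⁻¹ := by
  unfold κE
  rw [max_eq_left]
  have := exp_four_mul_le hr
  linarith

/-- `1 ≤ κE r` for `r ≥ 0`. [folklore] -/
theorem one_le_κE {r : ℝ} (hr : 0 ≤ r) : 1 ≤ κE r := by
  unfold κE
  have h1 : 1 ≤ Real.exp (4 * r) := Real.one_le_exp (by linarith)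
  have hm : max (2 - Real.exp (4 * r)) (1 / 2) ≤ 1 := max_le (by linarith) (by norm_num)
  have hm0 : 0 < max (2 - Real.exp (4 * r)) (1 / 2) := lt_of_lt_of_le (by norm_num) (le_max_right _ _)
  rw [le_inv_comm₀ one_pos hm0, inv_one]
  exact hm

/-- `0 < κE r` for `r ≥ 0`. [folklore] -/
theorem κE_pos {r : ℝ} (hr : 0 ≤ r) : 0 < κE r := lt_of_lt_of_le one_pos (one_le_κE hr)

/-- `κE r ≤ 2` always. [folklore] -/
theorem κE_le_two (r : ℝ) : κE r ≤ 2 := by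
  unfold κE
  have hm0 : (1 / 2 : ℝ) ≤ max (2 - Real.exp (4 * r)) (1 / 2) := le_max_right _ _
  have hpos : 0 < max (2 - Real.exp (4 * r)) (1 / 2) := lt_of_lt_of_le (by norm_num) hm0
  rw [inv_le_comm₀ hpos two_pos]
  linarith

/-- `log κE(r) ≤ 16 r` for `0 ≤ r ≤ 1/16` (`2 − e^{4r} ≥ 1 − 8r` and `−log(1 − x) ≤ 2x` on `[0, 1/2]`). [folklore] -/
theorem log_κE_le {r : ℝ} (hr0 : 0 ≤ r) (hr : r ≤ 1 / 16) : Real.log (κE r) ≤ 16 * r := by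
  rw [κE_eq hr, Real.log_inv]
  -- `2 − e^{4r} ≥ 1 − 8r > 0`
  have hneg : 1 - 4 * r ≤ Real.exp (-(4 * r)) := Real.one_sub_le_exp_neg _
  have hprod : Real.exp (4 * r) * Real.exp (-(4 * r)) = 1 := by rw [← Real.exp_add]; simp
  have hexp_pos : 0 < Real.exp (4 * r) := Real.exp_pos _
  have h14 : 0 < 1 - 4 * r := by linarith
  have hup : Real.exp (4 * r) ≤ 1 / (1 - 4 * r) := by
    rw [le_div_iff₀ h14]; nlinarith
  have hkey : 1 - 8 * r ≤ 2 - Real.exp (4 * r) := by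
    have : 1 / (1 - 4 * r) ≤ 1 + 8 * r := by
      rw [div_le_iff₀ h14]; nlinarith
    linarith
  have hpos : 0 < 2 - Real.exp (4 * r) := by
    have := exp_four_mul_le hr; linarith
  have h18 : 0 < 1 - 8 * r := by linarith
  -- `-log(2 - e^{4r}) ≤ -log(1 - 8r) ≤ 16 r`
  have hlog1 : Real.log (1 - 8 * r) ≤ Real.log (2 - Real.exp (4 * r)) := Real.log_le_log h18 hkey
  have hlog2 : -(2 * (8 * r)) ≤ Real.log (1 - 8 * r) := by
    have h := Real.one_sub_inv_le_log_of_pos h18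
    have hinv : (1 - 8 * r)⁻¹ ≤ 1 + 2 * (8 * r) := by
      rw [inv_le_iff_one_le_mul₀' h18]
      nlinarith [mul_nonneg hr0 hr0]
    linarith
  linarith

end Kappa

/-! ### Lebesgue measure of Euclidean balls in `ℝ^D`, and two filter helpers -/

section Volume

open MeasureTheory Measure Metric
open scoped ENNReal

variable {D : ℕ}

/-- `vol b(a, δ) = δ^D vol b(0, 1)` in `ℝ^D`. [folklore] -/
theorem volume_closedBall_fin (a : EuclideanSpace ℝ (Fin D)) {δ : ℝ} (hδ : 0 ≤ δ) :
    volume (closedBall a δ) =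
      ENNReal.ofReal (δ ^ D) * volume (closedBall (0 : EuclideanSpace ℝ (Fin D)) 1) := by
  rw [Measure.addHaar_closedBall' volume a hδ, finrank_euclideanSpace_fin]

/-- Euclidean balls of positive radius have positive volume. [folklore] -/
theorem volume_closedBall_fin_pos (a : EuclideanSpace ℝ (Fin D)) {δ : ℝ} (hδ : 0 < δ) :
    0 < volume (closedBall a δ) :=
  Metric.measure_closedBall_pos volume a hδ

/-- Euclidean balls have finite volume. [folklore] -/
theorem volume_closedBall_fin_lt_top (a : EuclideanSpace ℝ (Fin D)) (δ : ℝ) : volume (closedBall a δ) < ∞ :=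
  measure_closedBall_lt_top

/-- Scaling of Euclidean balls: `vol b(a, kδ) = k^D vol b(a, δ)`. [folklore] -/
theorem volume_closedBall_fin_mul (a : EuclideanSpace ℝ (Fin D)) {k δ : ℝ} (hk : 0 < k) (hδ : 0 ≤ δ) :
    volume (closedBall a (k * δ)) = ENNReal.ofReal (k ^ D) * volume (closedBall a δ) := by
  rw [volume_closedBall_fin a (by positivity), volume_closedBall_fin a hδ, mul_pow,
    ENNReal.ofReal_mul (by positivity), mul_assoc]

/-- `κE` is continuous. [folklore] -/
theorem continuous_κE : Continuous κE := by
  unfold κE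
  refine Continuous.inv₀ (by fun_prop) fun r => ?_
  exact (lt_of_lt_of_le (by norm_num) (le_max_right _ _)).ne'

/-- `κE 0 = 1`. [folklore] -/
theorem κE_zero : κE 0 = 1 := by norm_num [κE]

end Volume
-- BODY END

end Summit.QuantumFields.YangMills.Theorems.FreeEnergyLogCoefficient

end
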